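import Literature.Computability.Complexity.OneInThreeSATLadder
import HarnessLib

/-!
# First-occurrence renaming of variables and the 2D-X-RAY instance of a ONE-IN-THREE 3SAT
# clause list

The ladder complex (`OneInThreeSATLadder.lean`) is laid out for clause lists whose variables are
`< n`; a code of ONE-IN-THREE 3SAT (`ONEIN3SAT`, `OneInThreeSAT.lean`) carries arbitrary binary
variable numerals. The polynomial-time reduction `1-IN-3-SAT → 2D-X-RAY` therefore first renames
every variable to the position of its first occurrence in the clause list (a number `< 3m` for `m`
clauses of three literals) — the usual "without loss of generality the variables are
`x_1, …, x_r`" of Gardner–Gritzmann–Prangenberg (Lemma 3.4: "a set `V` of `r` variables") made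
explicit — and then takes the ladder instance. This file proves that the renaming is harmless:

* `varList φ` (the variables in order of occurrence), `firstOcc φ v = (varList φ).idxOf v`,
  `rename φ` (every literal `(v, b)` becomes `(firstOcc φ v, b)`);
* `rename` preserves "three pairwise distinct literals per clause" (`isThreeLiteralClauses_rename`,
  the renaming being injective on occurring variables), has all variables `< |varList φ|`
  (`rename_vars_lt`) and preserves one-in-three satisfiability in both directions
  (`xSatisfiable_rename_iff`);
* **`xrayOf φ`**, the 2D-X-RAY instance of the ladder complex of `rename φ` with
  `n = |varList φ|` variable slots, and **`xrayOf_mem_twoDXRaySet_iff`**: for a clause list with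
  three pairwise distinct literals per clause, `xrayOf φ ∈ twoDXRaySet ↔ φ.XSatisfiable`.

## References

* [GardnerGritzmannPrangenberg1999] R. J. Gardner, P. Gritzmann, D. Prangenberg, Discrete Math.
  202 (1999) 45–71, Lemma 3.4 (the instance `(r, s; V, 𝒞)` of 1-IN-3-SAT).
* [GareyJohnson1979] M. R. Garey, D. S. Johnson, *Computers and Intractability* (1979), [LO4].
-/

namespace Literature.Computability.Complexity

namespace OneInThree

open Literature.Combinatorics.Enumerative.Tomography

/-! ### The renaming -/

/-- The variables of a clause list in order of occurrence (with repetitions). [folklore] -/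
def varList (φ : CNF ℕ) : List ℕ := φ.flatMap fun C => C.map Prod.fst

/-- The position of the first occurrence of a variable (`= |varList φ|` if it does not occur).
[folklore] -/
def firstOcc (φ : CNF ℕ) (v : ℕ) : ℕ := (varList φ).idxOf v

/-- Renaming a literal. [folklore] -/
def renameLit (φ : CNF ℕ) (ℓ : Literal ℕ) : Literal ℕ := (firstOcc φ ℓ.1, ℓ.2)

/-- **First-occurrence renaming**: every literal `(v, b)` becomes `(firstOcc φ v, b)`.
[folklore] -/
def rename (φ : CNF ℕ) : CNF ℕ := φ.map fun C => C.map (renameLit φ)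

/-- A variable of a literal of a clause occurs. [folklore] -/
theorem mem_varList {φ : CNF ℕ} {C : Clause ℕ} (hC : C ∈ φ) {ℓ : Literal ℕ} (hℓ : ℓ ∈ C) :
    ℓ.1 ∈ varList φ :=
  List.mem_flatMap.2 ⟨C, hC, List.mem_map.2 ⟨ℓ, hℓ, rfl⟩⟩

/-- First occurrences of occurring variables are positions. [folklore] -/
theorem firstOcc_lt {φ : CNF ℕ} {v : ℕ} (hv : v ∈ varList φ) : firstOcc φ v < (varList φ).length :=
  List.idxOf_lt_length_iff.2 hv

/-- The variable at its first occurrence. [folklore] -/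
theorem getElem_firstOcc {φ : CNF ℕ} {v : ℕ} (hv : v ∈ varList φ) :
    (varList φ)[firstOcc φ v]'(firstOcc_lt hv) = v :=
  List.getElem_idxOf (firstOcc_lt hv)

/-- `getD` form of the previous lemma. [folklore] -/
theorem getD_firstOcc {φ : CNF ℕ} {v : ℕ} (hv : v ∈ varList φ) : (varList φ).getD (firstOcc φ v) 0 = v := by
  rw [List.getD_eq_getElem _ _ (firstOcc_lt hv), getElem_firstOcc hv]

/-- The renaming is injective on occurring variables. [folklore] -/
theorem firstOcc_injOn {φ : CNF ℕ} {v v' : ℕ} (hv : v ∈ varList φ) (h : firstOcc φ v = firstOcc φ v') :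
    v = v' :=
  (List.idxOf_inj hv).1 h

/-- The number of occurrences of a clause list with three literals per clause. [folklore] -/
theorem length_varList {φ : CNF ℕ} (hφ : φ.IsThreeLiteralClauses) : (varList φ).length = 3 * φ.length := by
  unfold varList
  induction φ with
  | nil => rfl
  | cons C φ ih =>
    rw [List.flatMap_cons, List.length_append, List.length_map, (hφ C (by simp)).1,
      ih (fun C' hC' => hφ C' (List.mem_cons_of_mem _ hC')), List.length_cons]
    omega

/-- The renaming keeps the number of clauses. [folklore] -/
@[simp] theorem length_rename (φ : CNF ℕ) : (rename φ).length = φ.length := List.length_map _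

/-- **The renamed clause list has three pairwise distinct literals per clause** if the original has.
[folklore] -/
theorem isThreeLiteralClauses_rename {φ : CNF ℕ} (hφ : φ.IsThreeLiteralClauses) :
    (rename φ).IsThreeLiteralClauses := by
  intro C' hC'
  obtain ⟨C, hC, rfl⟩ := List.mem_map.1 hC'
  obtain ⟨h3, hnd⟩ := hφ C hC
  refine ⟨by rw [List.length_map, h3], hnd.map_on ?_⟩
  intro ℓ hℓ ℓ' hℓ' h
  have h1 : firstOcc φ ℓ.1 = firstOcc φ ℓ'.1 := by simpa [renameLit] using congrArg Prod.fst h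
  have h2 : ℓ.2 = ℓ'.2 := by simpa [renameLit] using congrArg Prod.snd h
  exact Prod.ext (firstOcc_injOn (mem_varList hC hℓ) h1) h2

/-- **All variables of the renamed clause list are `< |varList φ|`.** [folklore] -/
theorem rename_vars_lt (φ : CNF ℕ) : ∀ C ∈ rename φ, ∀ ℓ ∈ C, ℓ.1 < (varList φ).length := by
  intro C' hC' ℓ' hℓ'
  obtain ⟨C, hC, rfl⟩ := List.mem_map.1 hC'
  obtain ⟨ℓ, hℓ, rfl⟩ := List.mem_map.1 hℓ'
  exact firstOcc_lt (mem_varList hC hℓ)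

/-- Renamed literals evaluate like the originals under the transported assignment. [folklore] -/
theorem eval_renameLit {φ : CNF ℕ} (σ : ℕ → Bool) {ℓ : Literal ℕ} (hℓ : ℓ.1 ∈ varList φ) :
    Literal.eval (fun k => σ ((varList φ).getD k 0)) (renameLit φ ℓ) = Literal.eval σ ℓ := by
  simp only [Literal.eval, renameLit, getD_firstOcc hℓ]

/-- **The renaming preserves one-in-three satisfiability** (both directions). [folklore] -/
theorem xSatisfiable_rename_iff (φ : CNF ℕ) : (rename φ).XSatisfiable ↔ φ.XSatisfiable := by
  constructor
  · rintro ⟨σ', h⟩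
    refine ⟨fun v => σ' (firstOcc φ v), (CNF.xeval_eq_true_iff _ _).2 fun C hC => ?_⟩
    have := (CNF.xeval_eq_true_iff _ _).1 h (C.map (renameLit φ)) (List.mem_map.2 ⟨C, hC, rfl⟩)
    rw [List.countP_map] at this
    rw [← this]
    exact List.countP_congr fun ℓ _ => Iff.rfl
  · rintro ⟨σ, h⟩
    refine ⟨fun k => σ ((varList φ).getD k 0), (CNF.xeval_eq_true_iff _ _).2 fun C' hC' => ?_⟩
    obtain ⟨C, hC, rfl⟩ := List.mem_map.1 hC'
    rw [List.countP_map, ← (CNF.xeval_eq_true_iff _ _).1 h C hC]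
    apply List.countP_congr
    intro ℓ hℓ
    simp only [Function.comp_apply]
    rw [eval_renameLit σ (mem_varList hC hℓ)]

/-- Renaming commutes with negation. [folklore] -/
theorem renameLit_negate (φ : CNF ℕ) (ℓ : Literal ℕ) : renameLit φ ℓ.negate = (renameLit φ ℓ).negate := rfl

/-- **The renaming preserves complementary pairs** in clauses of `φ` (both directions, by
injectivity on occurring variables). [folklore] -/
theorem hasPair_map_renameLit {φ : CNF ℕ} {C : Clause ℕ} (hC : C ∈ φ) :
    HasPair (C.map (renameLit φ)) ↔ HasPair C := by
  constructor
  · rintro ⟨ℓ', hℓ', hn'⟩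
    obtain ⟨ℓ, hℓ, rfl⟩ := List.mem_map.1 hℓ'
    obtain ⟨ℓ₂, hℓ₂, h⟩ := List.mem_map.1 hn'
    have h1 : firstOcc φ ℓ₂.1 = firstOcc φ ℓ.1 := by simpa [renameLit, Literal.negate] using congrArg Prod.fst h
    have h2 : ℓ₂.2 = !ℓ.2 := by simpa [renameLit, Literal.negate] using congrArg Prod.snd h
    have hv : ℓ₂.1 = ℓ.1 := firstOcc_injOn (mem_varList hC hℓ₂) h1
    refine ⟨ℓ, hℓ, ?_⟩
    have : ℓ₂ = ℓ.negate := Prod.ext hv h2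
    rwa [this] at hℓ₂
  · rintro ⟨ℓ, hℓ, hn⟩
    exact ⟨renameLit φ ℓ, List.mem_map.2 ⟨ℓ, hℓ, rfl⟩, by
      rw [← renameLit_negate]; exact List.mem_map.2 ⟨_, hn, rfl⟩⟩

/-- Clause `c` of the renamed list. [folklore] -/
theorem getD_rename {φ : CNF ℕ} {c : ℕ} (hc : c < φ.length) :
    (rename φ).getD c [] = (φ[c]).map (renameLit φ) := by
  rw [rename, List.getD_eq_getElem _ _ (by simpa using hc), List.getElem_map]

/-- Complementary pairs in clause `c`, before and after renaming. [folklore] -/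
theorem hasPair_rename_getD {φ : CNF ℕ} {c : ℕ} (hc : c < φ.length) :
    HasPair ((rename φ).getD c []) ↔ HasPair (φ[c]) := by
  rw [getD_rename hc, hasPair_map_renameLit (List.getElem_mem hc)]

/-! ### The 2D-X-RAY instance of a clause list -/

/-- **The 2D-X-RAY instance of a clause list**: the ladder instance of its first-occurrence
renaming, with `|varList φ|` variable slots. [cite: GardnerGritzmannPrangenberg1999, Lemma 3.4] -/
noncomputable def xrayOf (φ : CNF ℕ) : List ℕ × List ℕ × List ℕ :=
  ladderInstance (varList φ).length (rename φ)

/-- **Correctness of the instance**: for a clause list with three pairwise distinct literals per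
clause, its 2D-X-RAY instance is consistent iff the clause list is one-in-three satisfiable.
[cite: GardnerGritzmannPrangenberg1999, Lemma 3.4] -/
theorem xrayOf_mem_twoDXRaySet_iff {φ : CNF ℕ} (hφ : φ.IsThreeLiteralClauses) :
    xrayOf φ ∈ twoDXRaySet ↔ φ.XSatisfiable := by
  rw [xrayOf, ladderInstance_mem_twoDXRaySet_iff (isThreeLiteralClauses_rename hφ) (rename_vars_lt φ),
    xSatisfiable_rename_iff]

end OneInThree

end Literature.Computability.Complexity
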